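import Mathlib.Analysis.SpecialFunctions.Pow.Asymptotics
import Literature.Computability.MetaComplexity.RefutationCNFHardnessProofs
import Literature.Computability.Complexity.E3InstanceMachine
import Literature.Computability.Complexity.KSATReductions
import Literature.Computability.Complexity.ClayProblemProofs
import Literature.Computability.Complexity.ReductionsProofs
import Literature.Computability.Complexity.PCPOfGapE3SAT
import Summits.PneNP.PneNP.Theorems.SoloInformedIOShape
import HarnessLib

/-!
# The proof-complexity face of the summit: `PneNP ↔ RESBOUND ∉ P`

Soloist file (`solo-PneNP-informed`; landing prefix `SoloInformed`). `RESBOUND` (`resBoundLang`) is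
the decision form of Resolution proof search: codes `⟨code F, w⟩` such that the CNF `F` has a
Resolution refutation with at most `|w|` lines. From the tree's Atserias–Müller hardness theorem
`rrefGadget_hardness_holds` [AtseriasMuller2020, Thm 2 (a)+(b)] for the gadget `G(F) = RREF(F,13n²)`,
a polynomial-time NORMALIZATION `SoloRes.normCNF` of 3-CNFs into its hypotheses (width `≤ 3`,
non-tautological clauses, `m ≤ 8n³`, `n ≥ n₀`; typed program `SoloRes.normFP`) and Cook–Levin
(`isNPComplete_kSAT_three_holds`) we get `3SAT ≤ₚ RESBOUND` and hence **`PneNP → RESBOUND ∉ P`**,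
given the named fact `rrefGadget_polyTime` ([AM20, Thm 2]: `G` is polynomial-time; used as a
hypothesis, D-0014); with the routine hypothesis `RESBOUND ∈ NP` also **`PneNP ↔ RESBOUND ∉ P`**
[AtseriasMuller2020, Thm 1]. A kernel-checked sharpening of the summit STATEMENT (its
automatability face), not progress toward it. Refs: A. Atserias, M. Müller, J. ACM 67(5) (2020)
Art. 31; S. Arora, B. Barak, *Computational Complexity* (2009) Thm. 2.8 [AroraBarakCC2009].
-/

namespace Summit.PneNP.PneNP.Theorems

open Literature.Computability.Complexity Literature.Computability.MetaComplexity
open _root_.Computability Literature.Computability.Complexity.Brick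
open scoped Notation

/-- **`RESBOUND`**: the codes `⟨code F, w⟩` (`boolPair` of the `encodingCNF`-code of a CNF `F` and an
arbitrary string `w`, the length budget in unary) such that `F` has a Resolution refutation with at
most `|w|` lines. [cite: AtseriasMuller2020, §1 (the proof-search problem for Resolution)] -/
def resBoundLang : Language Bool :=
  {x | ∃ (F : CNF ℕ) (w : List Bool), x = boolPair (encodingCNF.encode F) w ∧
    ∃ π : List (ResLine ℕ), IsResRefutation F π ∧ π.length ≤ w.length}

/-- Membership of a pair code in `RESBOUND`. [folklore] -/
theorem boolPair_mem_resBoundLang_iff (F : CNF ℕ) (w : List Bool) :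
    boolPair (encodingCNF.encode F) w ∈ resBoundLang ↔
      ∃ π : List (ResLine ℕ), IsResRefutation F π ∧ π.length ≤ w.length := by
  refine ⟨?_, fun h => ⟨F, w, rfl, h⟩⟩
  rintro ⟨F', w', h, hπ⟩
  have hinj := boolPair_injective (a₁ := (encodingCNF.encode F, w))
    (a₂ := (encodingCNF.encode F', w')) h
  simp only [Prod.mk.injEq] at hinj
  rw [encodingCNF.encode_injective hinj.1, hinj.2]
  exact hπ

/-- The empty string is not in `RESBOUND` (pair codes have length `≥ 2`). [folklore] -/
theorem nil_not_mem_resBoundLang : ([] : List Bool) ∉ resBoundLang := by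
  rintro ⟨F, w, h, -⟩
  have := congrArg List.length h
  simp only [List.length_nil, length_boolPair] at this
  omega

namespace SoloRes

/-- The clause `c` is tautological: it contains a literal together with its negation. [folklore] -/
def tautB (c : Clause ℕ) : Bool :=
  c.any fun l => decide (l.negate ∈ c)

/-- A tautological clause is replaced by the unit clause on the fresh variable `v`. [folklore] -/
def normClause (v : ℕ) (c : Clause ℕ) : Clause ℕ :=
  if tautB c then [(v, true)] else c

/-- `t` positive unit clauses on the fresh variables `v+1, …, v+t`. [folklore] -/
def freshUnits (v t : ℕ) : CNF ℕ :=
  (List.range t).map fun i => [(v + 1 + i, true)]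

/-- **The normalization** `N(F)`: tautological clauses replaced by `[x_v]` (`v = numVars F`, fresh)
and `|F| + n₀` fresh positive unit clauses appended (so that `n ≥ n₀`, `n ≥ |F| + n₀` and hence
`m = 2|F| + n₀ ≤ 8n³`). [cite: AtseriasMuller2020, §6 (proof of Thm 2: the hypotheses on F)] -/
def normCNF (n₀ : ℕ) (F : CNF ℕ) : CNF ℕ :=
  F.map (normClause F.numVars) ++ freshUnits F.numVars (F.length + n₀)

/-- A clause containing a literal and its negation is true under every assignment. [folklore] -/
theorem clause_eval_of_tautB {c : Clause ℕ} (h : tautB c = true) (σ : ℕ → Bool) :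
    c.eval σ = true := by
  obtain ⟨l, hl, hneg⟩ := List.any_eq_true.1 h
  rw [decide_eq_true_eq] at hneg
  rw [Clause.eval, List.any_eq_true]
  cases hval : l.eval σ
  · exact ⟨l.negate, hneg, by rw [Literal.eval_negate, hval]; rfl⟩
  · exact ⟨l, hl, hval⟩

/-- A non-tautological list clause is a non-tautological set clause. [folklore] -/
theorem isNonTaut_toFinset_of_tautB {c : Clause ℕ} (h : ¬ tautB c = true) :
    IsNonTaut c.toFinset := by
  rintro v ⟨h1, h2⟩
  rw [List.mem_toFinset] at h1 h2
  exact h (List.any_eq_true.2 ⟨(v, true), h1, by simpa [Literal.negate] using h2⟩)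

/-- A positive unit clause is non-tautological. [folklore] -/
theorem isNonTaut_unit (x : ℕ) : IsNonTaut ([(x, true)] : Clause ℕ).toFinset := by
  rintro v ⟨-, h2⟩
  simp at h2

/-- Membership in `N(F)`. [folklore] -/
theorem mem_normCNF_iff {n₀ : ℕ} {F : CNF ℕ} {c : Clause ℕ} :
    c ∈ normCNF n₀ F ↔ (∃ c₀ ∈ F, normClause F.numVars c₀ = c) ∨
      ∃ i < F.length + n₀, [(F.numVars + 1 + i, true)] = c := by
  simp [normCNF, freshUnits, List.mem_append, List.mem_map, List.mem_range]

/-- `N` preserves width `≤ 3`. [folklore] -/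
theorem isWidthLE_normCNF {F : CNF ℕ} (h : F.IsWidthLE 3) (n₀ : ℕ) : (normCNF n₀ F).IsWidthLE 3 := by
  intro c hc
  rcases mem_normCNF_iff.1 hc with ⟨c₀, hc₀, rfl⟩ | ⟨i, -, rfl⟩
  · unfold normClause
    split
    · simp
    · exact h c₀ hc₀
  · simp

/-- Every clause of `N(F)` is non-tautological. [folklore] -/
theorem isNonTaut_of_mem_normCNF (n₀ : ℕ) (F : CNF ℕ) :
    ∀ C ∈ (normCNF n₀ F).clauseFinsets, IsNonTaut C := by
  intro C hC
  obtain ⟨c, hc, rfl⟩ := List.mem_map.1 hC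
  rcases mem_normCNF_iff.1 hc with ⟨c₀, -, rfl⟩ | ⟨i, -, rfl⟩
  · unfold normClause
    split
    · exact isNonTaut_unit _
    · exact isNonTaut_toFinset_of_tautB ‹_›
  · exact isNonTaut_unit _

/-- `N(F)` has `2|F| + n₀` clauses. [folklore] -/
theorem length_normCNF (n₀ : ℕ) (F : CNF ℕ) : (normCNF n₀ F).length = 2 * F.length + n₀ := by
  simp [normCNF, freshUnits]
  omega

/-- `N(F)` has at least `|F| + n₀` variables (the fresh ones all occur). [folklore] -/
theorem le_card_vars_normCNF (n₀ : ℕ) (F : CNF ℕ) :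
    F.length + n₀ ≤ (CNF.vars (normCNF n₀ F)).card := by
  set t := F.length + n₀
  have hsub : (Finset.range t).image (fun i => F.numVars + 1 + i) ⊆ CNF.vars (normCNF n₀ F) := by
    intro x hx
    obtain ⟨i, hi, rfl⟩ := Finset.mem_image.1 hx
    rw [Finset.mem_range] at hi
    simp only [CNF.vars, List.mem_toFinset, List.mem_map, List.mem_flatten]
    exact ⟨(F.numVars + 1 + i, true), ⟨[(F.numVars + 1 + i, true)],
      mem_normCNF_iff.2 (Or.inr ⟨i, hi, rfl⟩), List.mem_singleton_self _⟩, rfl⟩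
  simpa [Finset.card_image_of_injective _ (fun a b h => by simpa using h : Function.Injective
    fun i => F.numVars + 1 + i)] using Finset.card_le_card hsub

/-- `m ≤ 8n³` for `N(F)` (when `n₀ ≥ 1`). [cite: AtseriasMuller2020, §6 ("Note m ≤ 8n³")] -/
theorem length_normCNF_le {n₀ : ℕ} (hn₀ : 1 ≤ n₀) (F : CNF ℕ) :
    (normCNF n₀ F).length ≤ 8 * (CNF.vars (normCNF n₀ F)).card ^ 3 := by
  have h1 := le_card_vars_normCNF n₀ F
  set n := (CNF.vars (normCNF n₀ F)).card
  rw [length_normCNF]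
  have h2 : n ≤ n ^ 3 := Nat.le_self_pow (by norm_num) n
  omega

/-- `N` preserves satisfiability. [folklore] -/
theorem satisfiable_normCNF_of {F : CNF ℕ} (h : F.Satisfiable) (n₀ : ℕ) :
    (normCNF n₀ F).Satisfiable := by
  obtain ⟨σ, hσ⟩ := h
  refine ⟨fun x => if x < F.numVars then σ x else true, ?_⟩
  rw [CNF.eval_eq_true_iff] at hσ ⊢
  intro c hc
  rcases mem_normCNF_iff.1 hc with ⟨c₀, hc₀, rfl⟩ | ⟨i, -, rfl⟩
  · unfold normClause
    split
    · simp [Clause.eval, Literal.eval]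
    · rw [← hσ c₀ hc₀]
      exact PCPOfGap.clause_eval_congr fun l hl => by
        simp [CNF.lt_numVars_of_mem_of_mem hc₀ hl]
  · have : ¬ (F.numVars + 1 + i < F.numVars) := by omega
    simp [Clause.eval, Literal.eval, this]

/-- `N` reflects satisfiability. [folklore] -/
theorem satisfiable_of_normCNF {F : CNF ℕ} {n₀ : ℕ} (h : (normCNF n₀ F).Satisfiable) :
    F.Satisfiable := by
  obtain ⟨σ, hσ⟩ := h
  refine ⟨σ, ?_⟩
  rw [CNF.eval_eq_true_iff] at hσ ⊢
  intro c₀ hc₀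
  by_cases ht : tautB c₀ = true
  · exact clause_eval_of_tautB ht σ
  · have hmem : c₀ ∈ normCNF n₀ F :=
      mem_normCNF_iff.2 (Or.inl ⟨c₀, hc₀, by simp [normClause, ht]⟩)
    exact hσ c₀ hmem

open Literature.Computability.Complexity.Expander.E3LC (cnfE cnfE_eq litE rawClausesFP numVarsFP
  ulengthFP lengthFP)

/-- The tautology test on clause codes (literal negation is `(fst, ¬snd)`; membership by the
injectivity of literal codes). [cite: AroraBarakCC2009, §1.3] -/
theorem tautFP : CodeFP (CodeFP.rawE litE) CodeFP.bitE tautB := by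
  have hneg : CodeFP litE litE Literal.negate :=
    ((CodeFP.fst CodeFP.natE CodeFP.bitE).pair (CodeFP.snd CodeFP.natE CodeFP.bitE).not).congr
      fun _ => rfl
  have hp : CodeFP (CodeFP.pairE (CodeFP.rawE litE) litE) CodeFP.bitE
      (fun q => decide (Literal.negate q.2 ∈ q.1)) :=
    ((CodeFP.mem (CodeFP.pairE_injective CodeFP.natE_injective CodeFP.bitE_injective)).comp
      ((hneg.comp (CodeFP.snd _ _)).pair (CodeFP.fst _ _))).congr fun _ => rfl
  exact ((CodeFP.any hp).comp ((CodeFP.id (CodeFP.rawE litE)).pair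
    (CodeFP.id (CodeFP.rawE litE)))).congr fun _ => rfl

/-- `normClause` on codes (context: the fresh variable). [cite: AroraBarakCC2009, §1.3] -/
theorem normClauseFP : CodeFP (CodeFP.pairE CodeFP.natE (CodeFP.rawE litE)) (CodeFP.rawE litE)
    (fun p => normClause p.1 p.2) :=
  ((tautFP.comp (CodeFP.snd CodeFP.natE (CodeFP.rawE litE))).ite
    ((CodeFP.rawSingleton litE).comp
      ((CodeFP.fst CodeFP.natE (CodeFP.rawE litE)).pair (CodeFP.const _ true)))
    (CodeFP.snd CodeFP.natE (CodeFP.rawE litE))).congr fun _ => rfl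

/-- The fresh unit clause `[x_{v+1+i}]` on codes. [cite: AroraBarakCC2009, §1.3] -/
theorem unitFP : CodeFP (CodeFP.pairE CodeFP.natE CodeFP.natE) (CodeFP.rawE litE)
    (fun p => [(p.1 + 1 + p.2, true)]) :=
  ((CodeFP.rawSingleton litE).comp
    ((CodeFP.natAdd.comp ((CodeFP.natAdd.comp ((CodeFP.fst _ _).pair (CodeFP.const _ 1))).pair
      (CodeFP.snd _ _))).pair (CodeFP.const _ true))).congr fun _ => rfl

/-- `List.range (|F| + n₀)` on codes. [cite: AroraBarakCC2009, §1.3 (bounded loops)] -/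
theorem rangeFP (n₀ : ℕ) : CodeFP cnfE (CodeFP.rawE CodeFP.natE) (fun F => List.range (F.length + n₀)) :=
  (CodeFP.rangeOf.comp ((CodeFP.unAdd.comp (ulengthFP.pair (CodeFP.const _ n₀))).pair
    (CodeFP.natAdd.comp (lengthFP.pair (CodeFP.const _ n₀))))).congr fun F => by
      simp

/-- `freshUnits (numVars F) (|F| + n₀)` on codes. [cite: AroraBarakCC2009, §1.3] -/
theorem freshUnitsFP (n₀ : ℕ) : CodeFP cnfE (CodeFP.rawE (CodeFP.rawE litE))
    (fun F => freshUnits F.numVars (F.length + n₀)) :=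
  ((CodeFP.map unitFP).comp (numVarsFP.pair (rangeFP n₀))).congr fun _ => rfl

/-- `N(F)` as a raw clause list on codes. [cite: AroraBarakCC2009, §1.3] -/
theorem normRawFP (n₀ : ℕ) : CodeFP cnfE (CodeFP.rawE (CodeFP.rawE litE)) (normCNF n₀) :=
  ((CodeFP.rawAppend (CodeFP.rawE litE)).comp
    (((CodeFP.map normClauseFP).comp (numVarsFP.pair rawClausesFP)).pair (freshUnitsFP n₀))).congr
    fun _ => rfl

/-- From raw clause lists back to CNF codes. [cite: AroraBarakCC2009, §1.3] -/
theorem toCnfFP : CodeFP (CodeFP.rawE (CodeFP.rawE litE)) cnfE (fun φ => φ) :=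
  ((CodeFP.listOfRaw (CodeFP.listE litE)).comp (CodeFP.map₀ (CodeFP.listOfRaw litE))).congr
    fun φ => by simp

/-- **`N` is polynomial-time computable on codes.** [cite: AroraBarakCC2009, §1.3] -/
theorem normFP (n₀ : ℕ) : CodeFP cnfE cnfE (normCNF n₀) :=
  (toCnfFP.comp (normRawFP n₀)).congr fun _ => rfl

/-- The size of a CNF in unary, on codes. [cite: AroraBarakCC2009, §1.3] -/
theorem usizeFP : CodeFP cnfE CodeFP.unE CNF.size :=
  ((CodeFP.ulength litE).comp ((CodeFP.flatten litE).comp rawClausesFP)).congr fun φ => by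
    simp [CNF.size, List.length_flatten]

/-- A fixed power in unary, on codes. [cite: AroraBarakCC2009, §1.3] -/
theorem upowFP : ∀ k : ℕ, CodeFP CodeFP.unE CodeFP.unE (fun s => s ^ k)
  | 0 => (CodeFP.const _ 1).congr fun _ => by rw [pow_zero]
  | k + 1 => (CodeFP.unMul.comp ((upowFP k).pair (CodeFP.id CodeFP.unE))).congr fun _ => by
      simp [pow_succ]

/-- The instance map `F ↦ ⟨G(N F), 1^{|G(N F)|^C}⟩` on codes, given the named fact
`rrefGadget_polyTime`. [cite: AtseriasMuller2020, Thm 2 (G polynomial-time)] -/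
theorem instanceFP (hG : rrefGadget_polyTime) (n₀ C : ℕ) :
    CodeFP cnfE (CodeFP.pairE cnfE CodeFP.unE)
      (fun F => (rrefGadget (normCNF n₀ F), (rrefGadget (normCNF n₀ F)).size ^ C)) := by
  have hG' : CodeFP cnfE cnfE rrefGadget := by
    have h : CodeFP encodingCNF.encode encodingCNF.encode rrefGadget := hG
    rwa [cnfE_eq] at h
  have hGN : CodeFP cnfE cnfE (fun F => rrefGadget (normCNF n₀ F)) := hG'.comp (normFP n₀)
  exact hGN.pair ((upowFP C).comp (usizeFP.comp hGN))

/-- For every `C : ℕ` and `d > 0`: `r ^ C ≤ 2 ^ (r ^ (1/d))` for all large `r` (`log r = o(r^{1/d})`).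
[folklore] -/
theorem exists_pow_le_two_rpow (C : ℕ) {d : ℝ} (hd : 0 < d) :
    ∃ R : ℕ, ∀ r : ℕ, R ≤ r → ((r : ℝ) ^ C : ℝ) ≤ (2 : ℝ) ^ ((r : ℝ) ^ (1 / d)) := by
  have hε : 0 < Real.log 2 / (C + 1) := by positivity
  obtain ⟨A, hA⟩ := Filter.eventually_atTop.1
    ((isLittleO_log_rpow_atTop (r := 1 / d) (by positivity)).def hε)
  refine ⟨max 1 ⌈A⌉₊, fun r hr => ?_⟩
  have hr1 : (1 : ℝ) ≤ r := by exact_mod_cast (le_max_left _ _).trans hr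
  have hb := hA r (Nat.ceil_le.1 ((le_max_right _ _).trans hr))
  rw [Real.norm_of_nonneg (Real.log_nonneg hr1), Real.norm_of_nonneg (by positivity)] at hb
  have hC : (C : ℝ) ≤ C + 1 := by linarith
  have hlog : 0 ≤ Real.log r := Real.log_nonneg hr1
  have key : (C : ℝ) * Real.log r ≤ Real.log 2 * (r : ℝ) ^ (1 / d) :=
    calc (C : ℝ) * Real.log r ≤ (C + 1) * (Real.log 2 / (C + 1) * (r : ℝ) ^ (1 / d)) := by gcongr
      _ = Real.log 2 * (r : ℝ) ^ (1 / d) := by field_simp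
  calc ((r : ℝ) ^ C : ℝ) = Real.exp (Real.log r * C) := by
        rw [← Real.rpow_natCast, Real.rpow_def_of_pos (one_pos.trans_le hr1)]
    _ ≤ Real.exp (Real.log 2 * (r : ℝ) ^ (1 / d)) := Real.exp_le_exp.2 (by rw [mul_comm]; exact key)
    _ = (2 : ℝ) ^ ((r : ℝ) ^ (1 / d)) := by rw [Real.rpow_def_of_pos two_pos]

/-- **Correctness of the instance map on normalized inputs** (the two cases of
[AM20, Thm 2 (a)+(b)] with the threshold `|G(N F)|^C`, `C = ⌈c⌉`): there are `n₁` and `C` such that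
for every 3-CNF `F`, `F` is satisfiable iff `G(N F)` has a refutation with at most `|G(N F)|^C` lines.
[cite: AtseriasMuller2020, Thm 2 (a)+(b) and §6] -/
theorem exists_threshold :
    ∃ n₁ C : ℕ, ∀ F : CNF ℕ, F.IsWidthLE 3 →
      (F.Satisfiable ↔ ∃ π : List (ResLine ℕ), IsResRefutation (rrefGadget (normCNF n₁ F)) π ∧
        π.length ≤ (rrefGadget (normCNF n₁ F)).size ^ C) := by
  obtain ⟨c, d, hc, hd, n₀, hAM⟩ := rrefGadget_hardness_holds
  obtain ⟨R, hR⟩ := exists_pow_le_two_rpow ⌈c⌉₊ hd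
  refine ⟨max n₀ (max R 1), ⌈c⌉₊, fun F hw => ?_⟩
  set n₁ := max n₀ (max R 1)
  set G := rrefGadget (normCNF n₁ F)
  have hcard : n₁ ≤ _ := (Nat.le_add_left _ _).trans (le_card_vars_normCNF n₁ F)
  have hn₀ : n₀ ≤ (CNF.vars (normCNF n₁ F)).card := (le_max_left _ _).trans hcard
  have h1 : 1 ≤ n₁ := (le_max_right _ _).trans (le_max_right _ _)
  have hr : (CNF.vars (normCNF n₁ F)).card ≤ G.size := card_vars_le_size_rrefGadget _
  have hrR : R ≤ G.size := ((le_max_left _ _).trans ((le_max_right _ _).trans hcard)).trans hr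
  have hr1 : 1 ≤ G.size := (h1.trans hcard).trans hr
  have hAMF := hAM (normCNF n₁ F) (isWidthLE_normCNF hw n₁) (isNonTaut_of_mem_normCNF n₁ F)
    (length_normCNF_le h1 F) hn₀
  constructor
  · intro hsat
    obtain ⟨π, hπ, hlen⟩ := hAMF.1 (satisfiable_normCNF_of hsat n₁)
    have hle : (G.size : ℝ) ^ c ≤ (G.size : ℝ) ^ (⌈c⌉₊ : ℝ) :=
      Real.rpow_le_rpow_of_exponent_le (by exact_mod_cast hr1) (Nat.le_ceil c)
    rw [Real.rpow_natCast] at hle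
    have : (π.length : ℝ) < ((G.size ^ ⌈c⌉₊ : ℕ) : ℝ) := by push_cast; exact hlen.trans_le hle
    exact ⟨π, hπ, (Nat.cast_lt.1 this).le⟩
  · rintro ⟨π, hπ, hlen⟩
    by_contra hunsat
    have hlow := hAMF.2 (fun h => hunsat (satisfiable_of_normCNF h)) π hπ
    have : ((G.size ^ ⌈c⌉₊ : ℕ) : ℝ) < π.length := by
      push_cast; exact (hR G.size hrR).trans_lt hlow
    exact absurd (Nat.cast_lt.1 this) (not_lt.2 hlen)

end SoloRes

/-- **`3SAT ≤ₚ RESBOUND`** (given the named fact `rrefGadget_polyTime`): a code of a 3-CNF `F` is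
sent to `⟨code G(N F), 1^{|G(N F)|^C}⟩`, every other string to the non-member `ε`.
[cite: AtseriasMuller2020, Thm 1 and Thm 2 (proof of Thm 1 from Thm 2)] -/
theorem soloInformed_kSAT_three_karpReducible_resBound (hG : rrefGadget_polyTime) :
    kSAT 3 ≤ₚ resBoundLang := by
  obtain ⟨n₁, C, hthr⟩ := SoloRes.exists_threshold
  obtain ⟨g, hgFP, hg⟩ := SoloRes.instanceFP hG n₁ C
  have hg' : ∀ F : CNF ℕ, g (encodingCNF.encode F) =
      boolPair (encodingCNF.encode (rrefGadget (SoloRes.normCNF n₁ F)))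
        (CodeFP.unE ((rrefGadget (SoloRes.normCNF n₁ F)).size ^ C)) := fun F => by
    have h := hg F
    simp only [CodeFP.pairE_apply] at h
    rwa [← Expander.E3LC.cnfE_eq] at h
  refine ⟨iteFn (andFn KSATRed.isCanonFn (KSATRed.widthLEFn 3)) g (fun _ => []),
    iteFn_mem_FP (andFn_mem_FP KSATRed.isCanonFn_mem_FP (KSATRed.widthLEFn_mem_FP 3)) hgFP
      (const_mem_FP _), fun x => ?_⟩
  show x ∈ kSAT 3 ↔ iteFn _ g _ x ∈ resBoundLang
  by_cases hx : encodingCNF.encode (NegCNF.decCNF x) = x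
  · rw [← hx]
    have hcan : KSATRed.isCanonFn (encodingCNF.encode (NegCNF.decCNF x)) = [true] := by
      rw [KSATRed.isCanonFn_apply, KSATRed.decCNF_encode]; simp
    rw [iteFn_apply (andFn_apply hcan (KSATRed.widthLEFn_encode 3 _)), mem_kSAT_iff, Bool.true_and]
    by_cases hw : CNF.IsWidthLE 3 (NegCNF.decCNF x)
    · rw [decide_eq_true hw, if_pos rfl, hg', boolPair_mem_resBoundLang_iff, CodeFP.length_unE,
        ← hthr _ hw]
      exact ⟨fun h => h.2, fun h => ⟨hw, h⟩⟩
    · rw [decide_eq_false hw, if_neg Bool.false_ne_true]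
      exact ⟨fun h => (hw h.1).elim, fun h => (nil_not_mem_resBoundLang h).elim⟩
  · have hcan : KSATRed.isCanonFn x = [false] := by rw [KSATRed.isCanonFn_apply]; simp [hx]
    obtain ⟨b, hb⟩ := KSATRed.oneBit_widthLEFn 3 x
    rw [iteFn_apply (andFn_apply hcan hb), Bool.false_and, if_neg Bool.false_ne_true]
    exact ⟨fun h => (hx (KSATRed.encode_decCNF_of_mem h)).elim, (nil_not_mem_resBoundLang ·|>.elim)⟩

/-- **`RESBOUND ∈ P ⟹ NP ⊆ P`** (3SAT is NP-hard, `isNPComplete_kSAT_three_holds`; `P` is closed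
under `≤ₚ`). [cite: AtseriasMuller2020, Thm 1] [cite: AroraBarakCC2009, Thm. 2.8] -/
theorem soloInformed_NP_subset_P_of_resBound_mem_P (hG : rrefGadget_polyTime)
    (hP : resBoundLang ∈ Classes.P) : Nondeterministic.NP ⊆ Classes.P :=
  NP_subset_P_of_isNPHard_of_mem_P_holds isNPComplete_kSAT_three_holds.isHard
    (mem_P_of_karpReducible_holds (soloInformed_kSAT_three_karpReducible_resBound hG) hP)

/-- **`PneNP → RESBOUND ∉ P`**: if `P ≠ NP` then bounded Resolution proof search is not decidable
in polynomial time (non-automatability, decision form). [cite: AtseriasMuller2020, Thm 1] -/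
theorem soloInformed_resBound_not_mem_P_of_pneNP (hG : rrefGadget_polyTime) (h : PneNP) :
    resBoundLang ∉ Classes.P := by
  intro hP
  obtain ⟨L, hL, hLP⟩ := soloInformed_pneNP_iff_exists_not_mem.1 h
  exact hLP (soloInformed_NP_subset_P_of_resBound_mem_P hG hP hL)

/-- **`RESBOUND ∈ NP ∖ P ⟹ PneNP`** (the easy converse: `RESBOUND` is then the separating
language). [folklore] -/
theorem soloInformed_pneNP_of_resBound_not_mem_P (hNP : resBoundLang ∈ Nondeterministic.NP)
    (h : resBoundLang ∉ Classes.P) : PneNP :=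
  soloInformed_pneNP_iff_exists_not_mem.2 ⟨resBoundLang, hNP, h⟩

/-- **The automatability face of the summit: `PneNP ↔ RESBOUND ∉ P`** (given `rrefGadget_polyTime`
and `RESBOUND ∈ NP`): `P ≠ NP` iff no polynomial-time algorithm decides, given a CNF `F` and `1ˢ`,
whether `F` has a Resolution refutation with at most `s` lines. [cite: AtseriasMuller2020, Thm 1] -/
theorem soloInformed_pneNP_iff_resBound_not_mem_P (hG : rrefGadget_polyTime)
    (hNP : resBoundLang ∈ Nondeterministic.NP) : PneNP ↔ resBoundLang ∉ Classes.P :=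
  ⟨soloInformed_resBound_not_mem_P_of_pneNP hG, soloInformed_pneNP_of_resBound_not_mem_P hNP⟩

end Summit.PneNP.PneNP.Theorems
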